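import Literature.NumberTheory.EllipticCurves.FormalGroupChart
import Mathlib.Algebra.Order.Archimedean.Basic
import HarnessLib

/-!
# `x ↦ F x - x` on the kernel of reduction over a complete unramified layer: successive
# approximation (the formal-group half of `H¹(K^un/K, E) = 0`)

`Proofs` file (theorems only, no definitions, no named facts) in topic
`NumberTheory/EllipticCurves`; a bottom-up step of the discharge of the named fact
`Literature.NumberTheory.EllipticCurves.Milne2006_unramifiedClass_eq_zero` (`PeriodIndexSupport`;
Milne, *Arithmetic Duality Theorems*, Prop. I.3.8: for an abelian variety `A` with good reduction
over a local field `K`, `H¹(Gal(K^un/K), A(K^un)) = 0`).  Milne's printed proof (p. 47) treats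
the identity component `𝒜°` with Lang's lemma on the special fibre and Hensel's lemma on a
torsor; the classical cocycle computation behind it (Tate 1962; Serre, *Local Fields*, XIII and
V §2 for the additive group) splits `A(K^un)` by the reduction map into `Ã(k̄)` (Lang) and the
kernel of reduction `A₁`, a pro-unipotent group filtered with graded pieces `k̄⁺`, on which the
vanishing of `H¹` of a finite unramified layer `K_n/K` (cyclic, generated by the Frobenius `F`)
is proved by **successive approximation in the complete field `K_n`**: a class is a point `m` of
`A₁(K_n)` with `Σ_{j<n} Fʲ m = 0`, and one solves `F P - P = m` level by level, the equation on
each graded piece `𝔪ʳ/𝔪ʳ⁺¹ ≅ k_n` being the additive Hilbert 90 `b^q - b = a` (`Tr a = 0`).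

This file proves that step for an elliptic curve, **abstractly**: for a Weierstrass equation `X`
over a field `E`, a field extension `L ⊇ E` with a valuation `w` for which `X_L` is integral, an
`E`-automorphism `F` of `L` preserving `w`, and an intermediate field `K_n` (the layer) stable
under `F` on which `Fⁿ = 1`, granted the four properties of a complete unramified layer as
hypotheses — (i) the value group of `K_n` is discrete with the uniformiser `π ∈ E`
(`|x| < 1 ⇒ |x| ≤ |π|`), (ii) the residue equation `F b - b ≡ a` is solvable in `𝒪_{K_n}` when
`Σ_{j<n} Fʲ a ≡ 0` (additive Hilbert 90 plus Teichmüller lifting), (iii) every `z ∈ 𝔪_{K_n}` is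
the parameter of a point of the kernel of reduction `E₁` with coordinates in `K_n` (Hensel), and
(iv) `K_n` is complete (`π`-adic Cauchy sequences converge) — the conclusion

* `FormalGroupChart.exists_map_sub_eq_of_sum_eq_zero`: **every `m ∈ E₁(K_n)` with
  `Σ_{j<n} Fʲ m = O` is `F P - P` for some `P ∈ E₁(K_n)`**

(`E₁ = FormalGroupChart.kernel w X_L`, points over `K_n` = the range of Mathlib's
`Affine.Point.map (K_n → L)`, `F` acting by `Affine.Point.map F`).  The hypotheses (i)–(iv) are
discharged for `K_n = K_v(ζ_{qⁿ-1}) ⊆ K̄_v` in the sibling files of this discharge.  The only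
input on the curve is the tree's chart calculus `FormalGroupChart` (Silverman, *AEC*, IV.1 and
VII.2.2 made quantitative: `|z(P + Q) - z(P) - z(Q)| ≤ max(|z(P)|, |z(Q)|)²`, `z` an isometric
injection of `E₁` into `𝔪`).

## The argument (`exists_map_sub_eq_of_sum_eq_zero`)

With `ρ = |π| < 1`: from `(m', P')` with `m' , P' ∈ E₁(K_n)`, `|z(m')| ≤ ρ^{r+1}`,
`Σ_{j<n} Fʲ m' = O` and `m = m' + (F P' - P')` one passes to level `r + 2`: `a = z(m')/π^{r+1}`
has `|Σ_{j<n} Fʲ a| ≤ ρ^{r+1} < 1` (the sum of the `z(Fʲ m')` is `z(O) = 0` up to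
`max |z|²`, `val_zCoord_sum_sub_sum_le`), so (ii) gives `b` with `|F b - b - a| < 1`, hence
`≤ ρ` by (i); the point `Q ∈ E₁(K_n)` with `z(Q) = π^{r+1} b` (iii) satisfies
`|z(m' + Q) - z(F Q)| ≤ ρ^{r+2}`, i.e. `m'' = m' - (F Q - Q)` has `|z(m'')| ≤ ρ^{r+2}`, and
`Σ_{j<n} Fʲ m'' = Σ Fʲ m' - (Fⁿ Q - Q) = O`.  The partial sums `P_r` have `π`-adically Cauchy
parameters (`|z(P_{r+1}) - z(P_r)| = |z(Q_r)| ≤ ρ^{r+1}`, `val_zCoord_add_sub_eq`), converging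
by (iv) to some `y ∈ 𝔪_{K_n}`, the parameter of a point `P ∈ E₁(K_n)` (iii); then
`m - (F P - P) = m'_r - (F D_r - D_r)` with `D_r = P - P_r`, `|z(D_r)| = |y - z(P_r)| ≤ ρ^{r+1}`
(`val_zCoord_sub`), has parameter of size `≤ ρ^{r+1}` for every `r`, hence `0`, so `F P - P = m`.

## References

* [MilneADT2006] J. S. Milne, *Arithmetic Duality Theorems*, 2nd ed. (2006), Prop. I.3.8 and
  its proof, Remark 3.9 (PDF pp. 46–47 of the author's edition).
* [SerreLocalFields1979] J.-P. Serre, *Local Fields*, GTM 67 (1979), V §2 (filtration of the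
  units and its cohomology), XIII §1 (`H¹` of `Ẑ`-modules, Lang's theorem).
* [SilvermanAEC2009] J. H. Silverman, *The Arithmetic of Elliptic Curves*, 2nd ed. (2009), IV.1,
  IV.3.2, VII.2.2 (`E₁(K) ≅ Ê(𝓜)`, the filtration `Ê(𝓜ⁿ)`).

## Design

No definitions; `noncomputable section`; `open scoped Classical NNReal`; one universe `u` for
`E`, `L` (the consumers have `E = v.adicCompletion K`, `L = AlgebraicClosure E`, both in the
universe of `K`).  Points over the layer `K_n : IntermediateField E L` are the range of Mathlib's
`WeierstrassCurve.Affine.Point.map (IntermediateField.val K_n)`; the automorphism acts by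
`WeierstrassCurve.Affine.Point.map F`, its powers by `map (F ^ j)`.
-/

noncomputable section

open scoped Classical NNReal

namespace Literature.NumberTheory.EllipticCurves.FormalGroupChart

universe u

variable {E : Type u} [Field E] {L : Type u} [Field L] [Algebra E L]
variable {X : WeierstrassCurve E}

/-! ### Points along algebra homomorphisms: parameter, kernel of reduction, powers -/

section MapLemmas

variable {F' K' : Type u} [Field F'] [Field K'] [Algebra E F'] [Algebra E K']

/-- `z(f P) = f (z P)`: the parameter `z = -x/y` commutes with maps of points along algebra
homomorphisms. [folklore] -/
theorem zCoord_map (f : F' →ₐ[E] K') (P : (X.baseChange F').toAffine.Point) :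
    (WeierstrassCurve.Affine.Point.map f P).zCoord = f P.zCoord := by
  rcases P with _ | ⟨x, y, h⟩
  · change (0 : (X.baseChange K').toAffine.Point).zCoord = f (0 : (X.baseChange F').toAffine.Point).zCoord
    rw [WeierstrassCurve.Affine.Point.zCoord_zero, WeierstrassCurve.Affine.Point.zCoord_zero, map_zero]
  · rw [WeierstrassCurve.Affine.Point.map_some, WeierstrassCurve.Affine.Point.zCoord_some,
      WeierstrassCurve.Affine.Point.zCoord_some, map_div₀, map_neg]

/-- Powers of `map F` are `map (F ^ j)`. [folklore] -/
theorem map_pow_apply (F : K' →ₐ[E] K') (j : ℕ) (P : (X.baseChange K').toAffine.Point) :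
    WeierstrassCurve.Affine.Point.map (F ^ j) P = (WeierstrassCurve.Affine.Point.map F)^[j] P := by
  induction j generalizing P with
  | zero =>
    rw [pow_zero, Function.iterate_zero, id_eq]
    exact WeierstrassCurve.Affine.Point.map_id P
  | succ j ih =>
    rw [Function.iterate_succ_apply', ← ih, WeierstrassCurve.Affine.Point.map_map, pow_succ']
    rfl

variable {w : Valuation K' ℝ≥0} [hV : (X.baseChange K').IsIntegral w.integer]

/-- An isometric automorphism preserves the kernel of reduction `E₁ = {O} ∪ {|x| > 1}`.
[folklore] -/
theorem map_mem_kernel_iff {F : K' →ₐ[E] K'} (hFw : ∀ x, w (F x) = w x)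
    (P : (X.baseChange K').toAffine.Point) :
    WeierstrassCurve.Affine.Point.map F P ∈ kernel w (X.baseChange K') ↔
      P ∈ kernel w (X.baseChange K') := by
  rcases P with _ | ⟨x, y, h⟩
  · exact Iff.rfl
  · rw [WeierstrassCurve.Affine.Point.map_some, some_mem_kernel_iff, some_mem_kernel_iff, hFw]

end MapLemmas

/-! ### Sums in the kernel of reduction: `z` is additive to first order -/

section Sums

variable {K' : Type u} [Field K'] {w : Valuation K' ℝ≥0} {V : WeierstrassCurve K'}
  [hV : V.IsIntegral w.integer]

/-- **`|z(Σᵢ Pᵢ) - Σᵢ z(Pᵢ)| ≤ s²`** for points `Pᵢ ∈ E₁` with `|z(Pᵢ)| ≤ s` (iterate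
`val_zCoord_add_sub_le`, the level sets of `z` being subgroups, `val_zCoord_add_le`).
[cite: SilvermanAEC2009, IV.1 and Prop. VII.2.2] -/
theorem val_zCoord_sum_sub_sum_le {ι : Type*} (s : Finset ι) (P : ι → V.toAffine.Point)
    (hP : ∀ i ∈ s, P i ∈ kernel w V) {t : ℝ≥0}
    (hPt : ∀ i ∈ s, w (P i).zCoord ≤ t) :
    (∑ i ∈ s, P i) ∈ kernel w V ∧ w (∑ i ∈ s, P i).zCoord ≤ t ∧
      w ((∑ i ∈ s, P i).zCoord - ∑ i ∈ s, (P i).zCoord) ≤ t ^ 2 := by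
  classical
  induction s using Finset.induction_on with
  | empty =>
    refine ⟨by rw [Finset.sum_empty]; exact (kernel w V).zero_mem, ?_, ?_⟩
    · rw [Finset.sum_empty, WeierstrassCurve.Affine.Point.zCoord_zero, map_zero]; exact zero_le
    · rw [Finset.sum_empty, Finset.sum_empty, WeierstrassCurve.Affine.Point.zCoord_zero, sub_zero,
        map_zero]
      exact zero_le
  | insert a s ha ih =>
    obtain ⟨hmem, hle, herr⟩ := ih (fun i hi ↦ hP i (Finset.mem_insert_of_mem hi))
      (fun i hi ↦ hPt i (Finset.mem_insert_of_mem hi))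
    have haK : P a ∈ kernel w V := hP a (Finset.mem_insert_self a s)
    have hat : w (P a).zCoord ≤ t := hPt a (Finset.mem_insert_self a s)
    rw [Finset.sum_insert ha, Finset.sum_insert ha]
    refine ⟨(kernel w V).add_mem haK hmem, ?_, ?_⟩
    · exact (val_zCoord_add_le haK hmem).trans (max_le hat hle)
    · have h1 := val_zCoord_add_sub_le haK hmem
      have h2 : w ((P a + ∑ i ∈ s, P i).zCoord - (P a).zCoord - (∑ i ∈ s, P i).zCoord) ≤ t ^ 2 :=
        h1.trans (by gcongr; exact max_le hat hle)
      have : (P a + ∑ i ∈ s, P i).zCoord - ((P a).zCoord + ∑ i ∈ s, (P i).zCoord) =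
          ((P a + ∑ i ∈ s, P i).zCoord - (P a).zCoord - (∑ i ∈ s, P i).zCoord) +
            ((∑ i ∈ s, P i).zCoord - ∑ i ∈ s, (P i).zCoord) := by ring
      rw [this]
      exact w.map_add_le h2 herr

/-- `|z(A - B)| = |z(A) - z(B)| ≤ max(|z A|, |z B|)` on `E₁`. [folklore] -/
theorem val_zCoord_sub_le {A B : V.toAffine.Point} (hA : A ∈ kernel w V) (hB : B ∈ kernel w V) :
    w (A - B).zCoord ≤ max (w A.zCoord) (w B.zCoord) := by
  rw [← val_zCoord_sub hA hB]
  exact Valuation.map_sub w _ _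

end Sums

/-! ### The successive approximation -/

section Layer

variable {w : Valuation L ℝ≥0} [hV : (X.baseChange L).IsIntegral w.integer]
  {Kn : IntermediateField E L} {F : L →ₐ[E] L} {n : ℕ}

/-- The restriction of `F` to the `F`-stable layer `K_n`, as an `E`-algebra endomorphism.
(Auxiliary, produced existentially: no definition is introduced.) [folklore] -/
theorem exists_restrict (hFK : ∀ x : Kn, F x ∈ Kn) :
    ∃ F' : Kn →ₐ[E] Kn, ∀ x : Kn, ((F' x : Kn) : L) = F x := by
  refine ⟨{ toFun := fun x ↦ ⟨F x, hFK x⟩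
            map_one' := Subtype.ext (by simp)
            map_mul' := fun x y ↦ Subtype.ext (by simp)
            map_zero' := Subtype.ext (by simp)
            map_add' := fun x y ↦ Subtype.ext (by simp)
            commutes' := fun r ↦ Subtype.ext (by simp) }, fun x ↦ rfl⟩

/-- `F` maps `K_n`-points to `K_n`-points. [folklore] -/
theorem map_mem_range_of_mem_range (hFK : ∀ x : Kn, F x ∈ Kn)
    {P : (X.baseChange L).toAffine.Point}
    (hP : P ∈ (WeierstrassCurve.Affine.Point.map (IntermediateField.val Kn)).range) :
    WeierstrassCurve.Affine.Point.map F P ∈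
      (WeierstrassCurve.Affine.Point.map (W' := X) (IntermediateField.val Kn)).range := by
  obtain ⟨F', hF'⟩ := exists_restrict hFK
  obtain ⟨P₀, rfl⟩ := hP
  refine ⟨WeierstrassCurve.Affine.Point.map F' P₀, ?_⟩
  have hcomp : (IntermediateField.val Kn).comp F' = F.comp (IntermediateField.val Kn) :=
    AlgHom.ext fun x ↦ hF' x
  rw [WeierstrassCurve.Affine.Point.map_map, WeierstrassCurve.Affine.Point.map_map, hcomp]

/-- `Fⁿ` fixes the `K_n`-points when `Fⁿ = 1` on `K_n`. [folklore] -/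
theorem map_pow_eq_self_of_mem_range (hFn : ∀ x : Kn, (F ^ n) x = x)
    {P : (X.baseChange L).toAffine.Point}
    (hP : P ∈ (WeierstrassCurve.Affine.Point.map (IntermediateField.val Kn)).range) :
    WeierstrassCurve.Affine.Point.map (F ^ n) P = P := by
  obtain ⟨P₀, rfl⟩ := hP
  have hcomp : (F ^ n).comp (IntermediateField.val Kn) = IntermediateField.val Kn :=
    AlgHom.ext fun x ↦ hFn x
  rw [WeierstrassCurve.Affine.Point.map_map, hcomp]

/-- The parameter of a `K_n`-point lies in `K_n`. [folklore] -/
theorem exists_coe_eq_zCoord_of_mem_range {P : (X.baseChange L).toAffine.Point}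
    (hP : P ∈ (WeierstrassCurve.Affine.Point.map (IntermediateField.val Kn)).range) :
    ∃ z : Kn, (z : L) = P.zCoord := by
  obtain ⟨P₀, rfl⟩ := hP
  exact ⟨P₀.zCoord, (zCoord_map (IntermediateField.val Kn) P₀).symm⟩

/-- Telescoping: `Σ_{j<n} Fʲ (F Q - Q) = Fⁿ Q - Q`. [folklore] -/
theorem sum_map_pow_map_sub (Q : (X.baseChange L).toAffine.Point) :
    ∑ j ∈ Finset.range n, WeierstrassCurve.Affine.Point.map (F ^ j)
        (WeierstrassCurve.Affine.Point.map F Q - Q) =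
      WeierstrassCurve.Affine.Point.map (F ^ n) Q - Q := by
  have key : ∀ j, WeierstrassCurve.Affine.Point.map (F ^ j)
      (WeierstrassCurve.Affine.Point.map F Q - Q) =
      WeierstrassCurve.Affine.Point.map (F ^ (j + 1)) Q - WeierstrassCurve.Affine.Point.map (F ^ j) Q := by
    intro j
    rw [map_sub, WeierstrassCurve.Affine.Point.map_map, pow_succ]
    rfl
  simp_rw [key]
  rw [Finset.sum_range_sub (fun j ↦ WeierstrassCurve.Affine.Point.map (F ^ j) Q), pow_zero]
  congr 1
  exact WeierstrassCurve.Affine.Point.map_id Q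

/-- **One step of the successive approximation.**  Hypotheses (i)–(iii) of the module docstring;
given `m' ∈ E₁(K_n)` with `|z(m')| ≤ ρ^{r+1}` and `Σ_{j<n} Fʲ m' = O`, there is `Q ∈ E₁(K_n)`
with `|z(Q)| ≤ ρ^{r+1}` such that `m' - (F Q - Q)` (again in `E₁(K_n)` with vanishing
`F`-trace) has `|z| ≤ ρ^{r+2}`.  (Serre, *Local Fields*, V §2 / XIII §1 pattern: solve on the
graded piece `𝔪^{r+1}/𝔪^{r+2} ≅ k_n` by additive Hilbert 90.) [folklore] -/
theorem exists_step (hFw : ∀ x, w (F x) = w x) (hFK : ∀ x : Kn, F x ∈ Kn)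
    (hFn : ∀ x : Kn, (F ^ n) x = x) {π : E} {ρ : ℝ≥0} (hπ : w (algebraMap E L π) = ρ)
    (hρ0 : 0 < ρ) (hρ1 : ρ < 1) (hdisc : ∀ x : Kn, w (x : L) < 1 → w (x : L) ≤ ρ)
    (hres : ∀ a : Kn, w (a : L) ≤ 1 → w (∑ j ∈ Finset.range n, (F ^ j) (a : L)) < 1 →
      ∃ b : Kn, w (b : L) ≤ 1 ∧ w (F b - b - a) < 1)
    (hlift : ∀ z : Kn, w (z : L) < 1 → ∃ P : (X.baseChange L).toAffine.Point,
      P ∈ kernel w (X.baseChange L) ∧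
      P ∈ (WeierstrassCurve.Affine.Point.map (IntermediateField.val Kn)).range ∧ P.zCoord = z)
    (r : ℕ) {m' : (X.baseChange L).toAffine.Point} (hm'K : m' ∈ kernel w (X.baseChange L))
    (hm'R : m' ∈ (WeierstrassCurve.Affine.Point.map (IntermediateField.val Kn)).range)
    (hm'z : w m'.zCoord ≤ ρ ^ (r + 1))
    (hm's : ∑ j ∈ Finset.range n, WeierstrassCurve.Affine.Point.map (F ^ j) m' = 0) :
    ∃ Q : (X.baseChange L).toAffine.Point, Q ∈ kernel w (X.baseChange L) ∧
      Q ∈ (WeierstrassCurve.Affine.Point.map (IntermediateField.val Kn)).range ∧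
      w Q.zCoord ≤ ρ ^ (r + 1) ∧
      w (m' - (WeierstrassCurve.Affine.Point.map F Q - Q)).zCoord ≤ ρ ^ (r + 2) ∧
      ∑ j ∈ Finset.range n, WeierstrassCurve.Affine.Point.map (F ^ j)
        (m' - (WeierstrassCurve.Affine.Point.map F Q - Q)) = 0 := by
  have hρr0 : 0 < ρ ^ (r + 1) := pow_pos hρ0 _
  have hρr1 : ρ ^ (r + 1) < 1 := pow_lt_one₀ zero_le hρ1 (Nat.succ_ne_zero r)
  have hπ0 : (algebraMap E L π) ≠ 0 := by
    intro h; rw [h, map_zero] at hπ; exact hρ0.ne' (hπ ▸ rfl)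
  have hFπ : ∀ j : ℕ, (F ^ j) (algebraMap E L π) = algebraMap E L π := fun j ↦ AlgHom.commutes _ _
  have hFjw : ∀ (j : ℕ) (x : L), w ((F ^ j) x) = w x := by
    intro j
    induction j with
    | zero => intro x; rfl
    | succ j ih => intro x; rw [pow_succ', AlgHom.mul_apply, hFw, ih]
  -- the parameter `a = z(m')` and `a₀ = a / π^{r+1}`
  obtain ⟨a, ha⟩ := exists_coe_eq_zCoord_of_mem_range hm'R
  have haw : w (a : L) ≤ ρ ^ (r + 1) := by rw [ha]; exact hm'z
  set a₀ : Kn := a * (algebraMap E Kn π)⁻¹ ^ (r + 1) with ha₀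
  have hιπ : ((algebraMap E Kn π : Kn) : L) = algebraMap E L π := rfl
  have ha₀L : (a₀ : L) = a * ((algebraMap E L π)⁻¹) ^ (r + 1) := by
    rw [ha₀]; push_cast; rw [hιπ]
  have hwπinv : w ((algebraMap E L π)⁻¹ ^ (r + 1)) = (ρ ^ (r + 1))⁻¹ := by
    rw [map_pow, map_inv₀, hπ, inv_pow]
  have ha₀w : w (a₀ : L) ≤ 1 := by
    rw [ha₀L, map_mul, hwπinv]
    calc w (a : L) * (ρ ^ (r + 1))⁻¹ ≤ ρ ^ (r + 1) * (ρ ^ (r + 1))⁻¹ := by gcongr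
      _ = 1 := mul_inv_cancel₀ hρr0.ne'
  have haa₀ : (a : L) = (a₀ : L) * (algebraMap E L π) ^ (r + 1) := by
    rw [ha₀L, mul_assoc, ← mul_pow, inv_mul_cancel₀ hπ0, one_pow, mul_one]
  -- the `F`-trace of `a` is small: `|Σ Fʲ a| ≤ ρ^{2(r+1)}`
  have htrace : w (∑ j ∈ Finset.range n, (F ^ j) (a : L)) ≤ (ρ ^ (r + 1)) ^ 2 := by
    have hsum := val_zCoord_sum_sub_sum_le (w := w) (V := X.baseChange L) (Finset.range n)
      (fun j ↦ WeierstrassCurve.Affine.Point.map (F ^ j) m')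
      (fun j _ ↦ (map_mem_kernel_iff (hFjw j) m').mpr hm'K) (t := ρ ^ (r + 1))
      (fun j _ ↦ by rw [zCoord_map, hFjw]; exact hm'z)
    obtain ⟨-, -, herr⟩ := hsum
    rw [hm's, WeierstrassCurve.Affine.Point.zCoord_zero, zero_sub, Valuation.map_neg] at herr
    have : ∑ j ∈ Finset.range n, (F ^ j) (a : L) =
        ∑ j ∈ Finset.range n, (WeierstrassCurve.Affine.Point.map (F ^ j) m').zCoord := by
      refine Finset.sum_congr rfl fun j _ ↦ ?_
      rw [zCoord_map, ha]
    rw [this]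
    exact herr
  have htrace₀ : w (∑ j ∈ Finset.range n, (F ^ j) (a₀ : L)) < 1 := by
    have : ∑ j ∈ Finset.range n, (F ^ j) (a₀ : L) =
        (∑ j ∈ Finset.range n, (F ^ j) (a : L)) * ((algebraMap E L π)⁻¹) ^ (r + 1) := by
      rw [Finset.sum_mul]
      refine Finset.sum_congr rfl fun j _ ↦ ?_
      rw [ha₀L, map_mul, map_pow, map_inv₀, hFπ]
    rw [this, map_mul, hwπinv]
    calc w (∑ j ∈ Finset.range n, (F ^ j) (a : L)) * (ρ ^ (r + 1))⁻¹
        ≤ (ρ ^ (r + 1)) ^ 2 * (ρ ^ (r + 1))⁻¹ := by gcongr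
      _ = ρ ^ (r + 1) := by rw [sq, mul_assoc, mul_inv_cancel₀ hρr0.ne', mul_one]
      _ < 1 := hρr1
  -- solve on the graded piece and lift
  obtain ⟨b, hb1, hb⟩ := hres a₀ ha₀w htrace₀
  have hbρ : w (F b - b - a₀ : L) ≤ ρ := by
    have hmem : (F b - b - a₀ : L) = ((⟨F b, hFK b⟩ - b - a₀ : Kn) : L) := by push_cast; rfl
    rw [hmem] at hb ⊢
    exact hdisc _ hb
  set x : Kn := b * (algebraMap E Kn π) ^ (r + 1) with hxdef
  have hxL : (x : L) = (b : L) * (algebraMap E L π) ^ (r + 1) := by rw [hxdef]; push_cast; rw [hιπ]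
  have hxw : w (x : L) ≤ ρ ^ (r + 1) := by
    rw [hxL, map_mul, map_pow, hπ]
    calc w (b : L) * ρ ^ (r + 1) ≤ 1 * ρ ^ (r + 1) := by gcongr
      _ = ρ ^ (r + 1) := one_mul _
  obtain ⟨Q, hQK, hQR, hQz⟩ := hlift x (hxw.trans_lt hρr1)
  have hFQK : WeierstrassCurve.Affine.Point.map F Q ∈ kernel w (X.baseChange L) :=
    (map_mem_kernel_iff hFw Q).mpr hQK
  have hFQR := map_mem_range_of_mem_range hFK hQR
  refine ⟨Q, hQK, hQR, by rw [hQz]; exact hxw, ?_, ?_⟩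
  · -- the `z`-estimate at level `r + 2`
    have hmQ : m' + Q ∈ kernel w (X.baseChange L) := (kernel w (X.baseChange L)).add_mem hm'K hQK
    have e1 : m' - (WeierstrassCurve.Affine.Point.map F Q - Q) =
        (m' + Q) - WeierstrassCurve.Affine.Point.map F Q := by abel
    rw [e1, ← val_zCoord_sub hmQ hFQK, zCoord_map, hQz]
    have e2 : (m' + Q).zCoord - F (x : L) =
        ((m' + Q).zCoord - m'.zCoord - Q.zCoord) - (F x - x - a) := by rw [hQz, ← ha]; ring
    rw [e2]
    have h1 : w ((m' + Q).zCoord - m'.zCoord - Q.zCoord) ≤ ρ ^ (r + 2) := by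
      refine (val_zCoord_add_sub_le hm'K hQK).trans ?_
      have hmax : max (w m'.zCoord) (w Q.zCoord) ≤ ρ ^ (r + 1) :=
        max_le hm'z (by rw [hQz]; exact hxw)
      calc max (w m'.zCoord) (w Q.zCoord) ^ 2 ≤ (ρ ^ (r + 1)) ^ 2 := by gcongr
        _ = ρ ^ (r + 2) * ρ ^ r := by ring
        _ ≤ ρ ^ (r + 2) * 1 := by gcongr; exact pow_le_one₀ zero_le hρ1.le
        _ = ρ ^ (r + 2) := mul_one _
    have h2 : w (F (x : L) - x - a) ≤ ρ ^ (r + 2) := by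
      have e3 : F (x : L) - x - a = (F b - b - a₀) * (algebraMap E L π) ^ (r + 1) := by
        rw [hxL, haa₀, map_mul, map_pow, AlgHom.commutes]
        ring
      rw [e3, map_mul, map_pow, hπ, pow_succ ρ (r + 1), mul_comm (ρ ^ (r + 1))]
      gcongr
    exact (Valuation.map_sub w _ _).trans (max_le h1 h2)
  · -- the `F`-trace of the new point vanishes
    have hdist : ∀ j, WeierstrassCurve.Affine.Point.map (F ^ j)
        (m' - (WeierstrassCurve.Affine.Point.map F Q - Q)) =
        WeierstrassCurve.Affine.Point.map (F ^ j) m' -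
          WeierstrassCurve.Affine.Point.map (F ^ j) (WeierstrassCurve.Affine.Point.map F Q - Q) :=
      fun j ↦ map_sub _ _ _
    simp_rw [hdist]
    rw [Finset.sum_sub_distrib, hm's, sum_map_pow_map_sub, map_pow_eq_self_of_mem_range hFn hQR,
      sub_self, sub_zero]

/-- **Successive approximation on the kernel of reduction over a complete unramified layer.**
Let `X` be a Weierstrass equation over a field `E`, `L ⊇ E` a field with a valuation `w` for
which `X_L` is integral, `F` an `E`-automorphism of `L` with `|F x| = |x|`, `K_n ⊆ L` an
intermediate field stable under `F` with `Fⁿ = 1` on `K_n`, and `π ∈ E` with `0 < |π| = ρ < 1`,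
such that: (i) `|x| < 1 ⇒ |x| ≤ ρ` on `K_n`; (ii) for `a ∈ 𝒪_{K_n}` with
`|Σ_{j<n} Fʲ a| < 1` there is `b ∈ 𝒪_{K_n}` with `|F b - b - a| < 1`; (iii) every `z ∈ K_n`
with `|z| < 1` is the parameter `z(P)` of a point `P ∈ E₁` with coordinates in `K_n`; (iv) every
sequence `(x_r)` in `K_n` with `|x_{r+1} - x_r| ≤ ρ^{r+1}` has a limit `y ∈ K_n`,
`|y - x_r| ≤ ρ^{r+1}`.  Then **every `m ∈ E₁(K_n)` with `Σ_{j<n} Fʲ m = O` is of the form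
`F P - P` with `P ∈ E₁(K_n)`** — the vanishing of `H¹(Gal(K_n/K), E₁(K_n))` for the cyclic
unramified layer `K_n/K` generated by the Frobenius `F`, which is the formal-group half of
Milne, *ADT*, Prop. I.3.8 (`H¹(G/I, A(K^un)) = 0` for good reduction; printed proof via Lang's
lemma and Hensel's lemma on `𝒜°`-torsors) in the classical cocycle form (Tate 1962; Serre,
*Local Fields*, V §2, XIII §1).  Proof: module docstring.
[cite: MilneADT2006, Ch. I Prop. 3.8 (proof: the identity component)] -/
theorem exists_map_sub_eq_of_sum_eq_zero (hFw : ∀ x, w (F x) = w x) (hFK : ∀ x : Kn, F x ∈ Kn)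
    (hFn : ∀ x : Kn, (F ^ n) x = x) {π : E} {ρ : ℝ≥0} (hπ : w (algebraMap E L π) = ρ)
    (hρ0 : 0 < ρ) (hρ1 : ρ < 1) (hdisc : ∀ x : Kn, w (x : L) < 1 → w (x : L) ≤ ρ)
    (hres : ∀ a : Kn, w (a : L) ≤ 1 → w (∑ j ∈ Finset.range n, (F ^ j) (a : L)) < 1 →
      ∃ b : Kn, w (b : L) ≤ 1 ∧ w (F b - b - a) < 1)
    (hlift : ∀ z : Kn, w (z : L) < 1 → ∃ P : (X.baseChange L).toAffine.Point,
      P ∈ kernel w (X.baseChange L) ∧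
      P ∈ (WeierstrassCurve.Affine.Point.map (IntermediateField.val Kn)).range ∧ P.zCoord = z)
    (hcomplete : ∀ x : ℕ → Kn, (∀ r, w ((x (r + 1) : L) - x r) ≤ ρ ^ (r + 1)) →
      ∃ y : Kn, ∀ r, w ((y : L) - x r) ≤ ρ ^ (r + 1))
    {m : (X.baseChange L).toAffine.Point} (hmK : m ∈ kernel w (X.baseChange L))
    (hmR : m ∈ (WeierstrassCurve.Affine.Point.map (IntermediateField.val Kn)).range)
    (hms : ∑ j ∈ Finset.range n, WeierstrassCurve.Affine.Point.map (F ^ j) m = 0) :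
    ∃ P : (X.baseChange L).toAffine.Point, P ∈ kernel w (X.baseChange L) ∧
      P ∈ (WeierstrassCurve.Affine.Point.map (IntermediateField.val Kn)).range ∧
      WeierstrassCurve.Affine.Point.map F P - P = m := by
  -- the invariant of the recursion, at level `r` (bound `ρ^{r+1}`):
  -- `s = (m', P')` with `m', P' ∈ E₁(K_n)`, `|z(m')| ≤ ρ^{r+1}`, `Σ Fʲ m' = O`, `m = m' + (F P' - P')`
  let Inv : ℕ → (X.baseChange L).toAffine.Point × (X.baseChange L).toAffine.Point → Prop := fun r s ↦
    s.1 ∈ kernel w (X.baseChange L) ∧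
    s.1 ∈ (WeierstrassCurve.Affine.Point.map (W' := X) (IntermediateField.val Kn)).range ∧
    s.2 ∈ kernel w (X.baseChange L) ∧
    s.2 ∈ (WeierstrassCurve.Affine.Point.map (W' := X) (IntermediateField.val Kn)).range ∧
    w s.1.zCoord ≤ ρ ^ (r + 1) ∧
    ∑ j ∈ Finset.range n, WeierstrassCurve.Affine.Point.map (F ^ j) s.1 = 0 ∧
    m = s.1 + (WeierstrassCurve.Affine.Point.map F s.2 - s.2)
  -- level `0`
  have hm0 : w m.zCoord ≤ ρ ^ (0 + 1) := by
    obtain ⟨a, ha⟩ := exists_coe_eq_zCoord_of_mem_range hmR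
    rw [zero_add, pow_one, ← ha]
    exact hdisc a (by rw [ha]; exact val_zCoord_lt_one hmK)
  have hInv0 : Inv 0 (m, 0) := by
    refine ⟨hmK, hmR, (kernel w (X.baseChange L)).zero_mem, AddSubgroup.zero_mem _, hm0, hms, ?_⟩
    change m = m + (WeierstrassCurve.Affine.Point.map F 0 - 0)
    rw [map_zero, sub_zero, add_zero]
  -- the step
  have hstep : ∀ (r : ℕ) (s : {s // Inv r s}), ∃ s' : {s' // Inv (r + 1) s'},
      w (s'.1.2.zCoord - s.1.2.zCoord) ≤ ρ ^ (r + 1) := by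
    rintro r ⟨⟨m', P'⟩, hs⟩
    obtain ⟨hm'K, hm'R, hP'K, hP'R, hm'z, hm's, hmP'⟩ := hs
    dsimp only at hm'K hm'R hP'K hP'R hm'z hm's hmP'
    obtain ⟨Q, hQK, hQR, hQz, hz, hs⟩ := exists_step hFw hFK hFn hπ hρ0 hρ1 hdisc hres hlift r
      hm'K hm'R hm'z hm's
    have hFQK : WeierstrassCurve.Affine.Point.map F Q ∈ kernel w (X.baseChange L) :=
      (map_mem_kernel_iff hFw Q).mpr hQK
    have hFQR := map_mem_range_of_mem_range hFK hQR
    refine ⟨⟨(m' - (WeierstrassCurve.Affine.Point.map F Q - Q), P' + Q),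
      (kernel w (X.baseChange L)).sub_mem hm'K ((kernel w (X.baseChange L)).sub_mem hFQK hQK),
      AddSubgroup.sub_mem _ hm'R (AddSubgroup.sub_mem _ hFQR hQR),
      (kernel w (X.baseChange L)).add_mem hP'K hQK,
      AddSubgroup.add_mem _ hP'R hQR, hz, hs, ?_⟩, ?_⟩
    · change m = (m' - (WeierstrassCurve.Affine.Point.map F Q - Q)) +
        (WeierstrassCurve.Affine.Point.map F (P' + Q) - (P' + Q))
      rw [hmP', map_add]; abel
    · change w ((P' + Q).zCoord - P'.zCoord) ≤ ρ ^ (r + 1)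
      rw [val_zCoord_add_sub_eq hP'K hQK]
      exact hQz
  choose next hnext using hstep
  -- the sequence of approximations
  let seq : ∀ r : ℕ, {s // Inv r s} := fun r ↦ Nat.rec ⟨(m, 0), hInv0⟩ (fun r s ↦ next r s) r
  have hseq_succ : ∀ r, seq (r + 1) = next r (seq r) := fun r ↦ rfl
  -- parameters of the partial sums lie in `K_n` and form a Cauchy sequence
  have hx : ∀ r, ∃ x : Kn, (x : L) = (seq r).1.2.zCoord := fun r ↦
    exists_coe_eq_zCoord_of_mem_range (seq r).2.2.2.2.1
  choose x hx using hx
  have hcauchy : ∀ r, w ((x (r + 1) : L) - x r) ≤ ρ ^ (r + 1) := by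
    intro r
    rw [hx, hx, hseq_succ]
    exact hnext r (seq r)
  obtain ⟨y, hy⟩ := hcomplete x hcauchy
  -- the limit point
  have hx0 : (x 0 : L) = 0 := by
    rw [hx]
    exact WeierstrassCurve.Affine.Point.zCoord_zero
  have hyw : w (y : L) < 1 := by
    have h := hy 0
    rw [hx0, sub_zero, zero_add, pow_one] at h
    exact h.trans_lt hρ1
  obtain ⟨P, hPK, hPR, hPz⟩ := hlift y hyw
  refine ⟨P, hPK, hPR, ?_⟩
  -- `T = m - (F P - P)` has arbitrarily small parameter
  have hFPK : WeierstrassCurve.Affine.Point.map F P ∈ kernel w (X.baseChange L) :=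
    (map_mem_kernel_iff hFw P).mpr hPK
  have hTK : m - (WeierstrassCurve.Affine.Point.map F P - P) ∈ kernel w (X.baseChange L) :=
    (kernel w (X.baseChange L)).sub_mem hmK ((kernel w (X.baseChange L)).sub_mem hFPK hPK)
  have hTsmall : ∀ r, w (m - (WeierstrassCurve.Affine.Point.map F P - P)).zCoord ≤ ρ ^ (r + 1) := by
    intro r
    obtain ⟨hm'K, -, hP'K, -, hm'z, -, hmP'⟩ := (seq r).2
    -- `D = P - P_r`
    have hDK : P - (seq r).1.2 ∈ kernel w (X.baseChange L) :=
      (kernel w (X.baseChange L)).sub_mem hPK hP'K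
    have hFDK : WeierstrassCurve.Affine.Point.map F (P - (seq r).1.2) ∈ kernel w (X.baseChange L) :=
      (map_mem_kernel_iff hFw _).mpr hDK
    have hDz : w (P - (seq r).1.2).zCoord ≤ ρ ^ (r + 1) := by
      rw [← val_zCoord_sub hPK hP'K, hPz, ← hx]
      exact hy r
    have hFD : w (WeierstrassCurve.Affine.Point.map F (P - (seq r).1.2) - (P - (seq r).1.2)).zCoord ≤
        ρ ^ (r + 1) := by
      refine (val_zCoord_sub_le hFDK hDK).trans (max_le ?_ hDz)
      rw [zCoord_map, hFw]
      exact hDz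
    have eT : m - (WeierstrassCurve.Affine.Point.map F P - P) =
        (seq r).1.1 - (WeierstrassCurve.Affine.Point.map F (P - (seq r).1.2) - (P - (seq r).1.2)) := by
      conv_lhs => rw [hmP']
      rw [map_sub]; abel
    rw [eT]
    exact (val_zCoord_sub_le hm'K ((kernel w (X.baseChange L)).sub_mem hFDK hDK)).trans
      (max_le hm'z hFD)
  have hTz : (m - (WeierstrassCurve.Affine.Point.map F P - P)).zCoord = 0 := by
    by_contra h0
    have hpos : 0 < w (m - (WeierstrassCurve.Affine.Point.map F P - P)).zCoord :=
      (Valuation.pos_iff w).mpr h0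
    obtain ⟨r, hr⟩ := exists_pow_lt_of_lt_one hpos hρ1
    have h1 : ρ ^ (r + 1) ≤ ρ ^ r := pow_le_pow_right_of_le_one' hρ1.le (Nat.le_succ r)
    exact lt_irrefl _ (((hTsmall r).trans h1).trans_lt hr)
  have hT0 := (zCoord_eq_zero_iff hTK).mp hTz
  rw [sub_eq_zero] at hT0
  exact hT0.symm

end Layer

end Literature.NumberTheory.EllipticCurves.FormalGroupChart

end
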